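import Summits.BirchSwinnertonDyer.BirchSwinnertonDyer.Theorems.KatoDescentTamePotSupersingularJetchevIrreducibleLocalFacts
import Summits.BirchSwinnertonDyer.BirchSwinnertonDyer.Theorems.Rank1ResidualJetCarrierAddEndForm
import HarnessLib

/-!
# Route `KatoDescentPotSupersingular` (rung K9, sub-rung B5 O6 wild 3, cell `bsd-potss`): crux `WildJetchevBoundAtP` (19941) —
# [J] Thm. 6.3 WITH THE CARRIER AT THE ADDITIVE PRIME `p` (the `H63Ip` schema of p520230/p522249 = the target of the
# candidate stub `stub_thm52KernelGapsAtP`) FROM bsd-jet's K4 END-FORM INPUT LIST read irreducible — the `q = p` twin of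
# `JET.jetchevDivisibilityCarrierAdd_of_localFacts` (Rank1ResidualJetCarrierAddEndForm.lean); seat `bsd-potss-k9-c4` g8;
# route-free; `--supports 19941`, helper; nothing booked, no item closed, BSD is not proved by any of this

WHAT IS PROVED. `thm63AtP_of_localFactsAtP`: for the ROW OBJECTS of 19941's S2p (non-CM `W`, Heegner field `d_K ∉ {−3,−4}`,
`τ ≠ 1`, odd ADDITIVE potentially good `p`, `E[p]` irreducible, tower not onto, lattice-optimal datum with `p ∤ c`, frame with
non-torsion `P_1`, depth functions, `m_∞`, a core vertex `c` of level `k > max(ord_p c_p, m_∞)`): `ord_p c_p(E) ≤ m_∞`, FROM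
bsd-jet's K4 closed-input list with `h44 ↦ h44I` (irreducible reading of [McC] Prop. 4.4 = 20165's `stub_prop44Irred`):
NAMED PRINT {`h44I`, `hPT` Poitou–Tate for Selmer structures, `h53` Gross 5.3 (∃ε form), `hGZ` [GZ86 III (3.1)] receptacle
(∃n′ form)}; LOCAL PRINT-TO-TYPE {`hloc` [J] Lemma 5.2 (i)(ii), `h𝒯σ` Gross §3, `h𝒯sd` Howard 2.1.9 (ii)}; ROW DATUM {`hΦ`:
`E(ℚ_ℓ)/E⁰` cyclic when `p ∣ c_ℓ` — at `ℓ = p = 3`, Kodaira IV/IV*, `Φ ≅ ℤ/3`}; COMPLETION-LAYER GAPS {`htr`, `h49str` =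
Jetchev Prop. 4.9 proper at the carrier places over `p` (x11b3's `localKummerMap_mem_connectedKummerCondition_of_cocycle_of_hasAdditiveReduction`
territory)}. Proof = bsd-jet's `jetchevDivisibilityCarrierAdd_of_localFacts` body (carrier `v₀ ∣ p` by `exists_split_place_of_dvd`,
row-data transport `carrierRowData_of_split`, intrinsic transverse family, `h49tr` from `htr` at level `cℓ`) ending in
`JetchevIrreducibleLocalFacts.tamagawaExponent_le_mInfty_of_localFacts_of_irreducible_of_heegner` instead of the tower line.
So, in the kernel: **`stub_thm52KernelGapsAtP` ⟸ K4's end-form inputs (irreducible)** — 19941's one specific stub is EXACTLY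
as closed as bsd-jet's road K4 (the tower-case `JetchevDivisibilityCarrierAdd`), no more, no less.
CONDITIONAL on every displayed input; nothing asserted; 19941, its stubs and BSD stay open.

References: [cite: Jetchev2008, Thm. 1.4, Thm. 5.1, Lemma 5.2, Thm. 5.2 (p. 821), Prop. 4.9, Prop. 5.3, Rem. 6.2]
[cite: McCallumLMS1991, §4 Prop. 4.4] [cite: GrossLMS1991, §3, Prop. 5.3, Prop. 6.2 (1)] [cite: GrossZagier1986, III (3.1)]
[cite: Howard2004HeegnerKolyvagin, Prop. 2.1.9, Lemma 2.7.3] [cite: MilneADT2006, Ch. I, Prop. 3.8, Thm. 4.10(b)].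
-/

set_option autoImplicit false
-- the Theorems directory repeats the summit name (sibling precedent `KatoDescentPotSupersingularAssembly.lean`)
set_option linter.dupNamespace false

noncomputable section

open scoped Classical Pointwise

open WeierstrassCurve IsDedekindDomain NumberField Field Literature.NumberTheory.EllipticCurves
  Literature.NumberTheory.EllipticCurves.ModularForms Literature.NumberTheory.EllipticCurves.Jetchev2008
  Literature.NumberTheory.EllipticCurves.Rank1Residual
  Literature.NumberTheory.GaloisRepresentations Literature.NumberTheory.GaloisCohomology
  Literature.NumberTheory.GaloisRepresentations.DiscreteGaloisModule
  Summit.BirchSwinnertonDyer.Rank1Residual.X11b Summit.BirchSwinnertonDyer.Rank1Residual.X11b.Three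
  Summit.BirchSwinnertonDyer.Rank1Residual.JET Summit.BirchSwinnertonDyer.Rank1Residual.JET.SelmerVocabulary
  Literature.NumberTheory.Automorphic
  Summit.BirchSwinnertonDyer.BirchSwinnertonDyer.Theorems

namespace Summit.BirchSwinnertonDyer.BirchSwinnertonDyer.Theorems.WildJetchevBoundAtPLocalFacts

/-- **`H63Ip` (Thm. 6.3 with the carrier at the additive `p`, for 19941's row objects) ⟸ bsd-jet's K4 end-form inputs read
irreducible** (`h44I`, `hPT`, `h53`, `hGZ`, `hloc`, `h𝒯σ`, `h𝒯sd`, `hΦ`, `htr`, `h49str`); every structure parameter from tree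
theorems via `JetchevIrreducibleLocalFacts.tamagawaExponent_le_mInfty_of_localFacts_of_irreducible_of_heegner`. CONDITIONAL;
nothing asserted. [cite: Jetchev2008, Thm. 5.2 (p. 821), Thm. 1.4] [cite: McCallumLMS1991, §4 Prop. 4.4] -/
theorem thm63AtP_of_localFactsAtP
    -- NAMED PRINT (irreducible reading of [McC] Prop. 4.4 = 20165's `stub_prop44Irred`; Poitou–Tate; Gross 5.3; [GZ III (3.1)])
    (h44I : ∀ (W : WeierstrassCurve ℚ) [W.IsElliptic] [W.IsGloballyMinimal] [NeZero (W.conductorNorm ℤ)],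
        ¬ W.HasCM →
        ∀ (K : Type) [Field K] [NumberField K], IsImaginaryQuadratic K →
        NumberField.discr K ≠ -3 → NumberField.discr K ≠ -4 →
        SatisfiesHeegnerHypothesis (W.conductorNorm ℤ) K →
        ∀ (p : ℕ) [Fact p.Prime], p ≠ 2 → W.HasIrreducibleModPGaloisRep p →
        ∀ (Dt : ModularParametrizationData W (W.conductorNorm ℤ)) (β : ℤ) (ι : K →+* ℂ)
          (M : ℕ), 1 ≤ M →
        ∀ (m l : ℕ), Squarefree (m * l) → l.Prime → ¬ l ∣ m →
          (∀ l' ∈ (m * l).primeFactors, Zhang2014.IsKolyvaginPrime (W.conductorNorm ℤ) W K p l' ∧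
            M ≤ Zhang2014.kolyvaginIndex W p l') →
        ∀ (d : KolyvaginHeegnerData Dt β ι m) (d' : KolyvaginHeegnerData Dt β ι (m * l)),
          (∀ l' ∈ m.primeFactors, ∀ (x : ringClassField K ι m) (x' : ringClassField K ι (m * l)),
            (x : ℂ) = x' → ((d'.σ l' x' : ringClassField K ι (m * l)) : ℂ) = (d.σ l' x : ℂ)) →
          (∀ s ∈ d.S, ∃ s' ∈ d'.S, ∀ (x : ringClassField K ι m) (x' : ringClassField K ι (m * l)),
            (x : ℂ) = x' → ((s' x' : ringClassField K ι (m * l)) : ℂ) = (s x : ℂ)) →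
          (∀ s' ∈ d'.S, ∃ s ∈ d.S, ∀ (x : ringClassField K ι m) (x' : ringClassField K ι (m * l)),
            (x : ℂ) = x' → ((s' x' : ringClassField K ι (m * l)) : ℂ) = (s x : ℂ)) →
          (∀ (x : ringClassField K ι m) (x' : ringClassField K ι (m * l)),
            (x : ℂ) = x' → d'.emb x' = d.emb x) →
        ∀ (v : HeightOneSpectrum (𝓞 K)), (l : 𝓞 K) ∈ v.asIdeal →
        ∀ (j : ℕ),
          (((p ^ j : ℕ) : ℤ) • d'.kolyvaginClass (Fact.out : p.Prime) M ∈
              selmerLocalKer (W.baseChange K) (v.adicCompletion K) ((p ^ M : ℕ) : ℤ) ↔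
            ((p ^ j : ℕ) : ℤ) • d'.kolyvaginClass (Fact.out : p.Prime) M ∈
              (W.baseChange K).torsionLocalKer (v.adicCompletion K) ((p ^ M : ℕ) : ℤ)) ∧
          (((p ^ j : ℕ) : ℤ) • d'.kolyvaginClass (Fact.out : p.Prime) M ∈
              (W.baseChange K).torsionLocalKer (v.adicCompletion K) ((p ^ M : ℕ) : ℤ) ↔
            ((p ^ j : ℕ) : ℤ) • d.kolyvaginClass (Fact.out : p.Prime) M ∈
              (W.baseChange K).torsionLocalKer (v.adicCompletion K) ((p ^ M : ℕ) : ℤ)))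
    (hPT : ∀ (K : Type) [Field K] [NumberField K], poitouTate_selmerStructure_duality_conj K)
    (h53 : ∀ (W : WeierstrassCurve ℚ) [W.IsElliptic] [NeZero (W.conductorNorm ℤ)]
      (K : Type) [Field K] [NumberField K]
      (Dt : ModularParametrizationData W (W.conductorNorm ℤ)) (β : ℤ) (ι : K →+* ℂ)
      [∀ j : ℕ, NumberField (ringClassField K ι j)],
      ∃ ε : ℤ, (ε = 1 ∨ ε = -1) ∧ ∀ (m : ℕ) (dm : KolyvaginHeegnerData Dt β ι m)
        (τm : ringClassField K ι m ≃ₐ[ℚ] ringClassField K ι m),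
        (∀ x : ringClassField K ι m, ((τm x : ringClassField K ι m) : ℂ) = starRingEnd ℂ x) →
        ∃ σ' ∈ ringClassGal ι m, IsOfFinAddOrder
          (pointGalHom W (ringClassField K ι m) τm dm.y -
            ε • pointGalHom W (ringClassField K ι m) σ' dm.y))
    (hGZ : ∀ (W : WeierstrassCurve ℚ) [W.IsElliptic] [NeZero (W.conductorNorm ℤ)]
      (K : Type) [Field K] [NumberField K] (p : ℕ) [Fact p.Prime]
      (Dt : ModularParametrizationData W (W.conductorNorm ℤ)) (β : ℤ) (ι : K →+* ℂ)
      [∀ j : ℕ, NumberField (ringClassField K ι j)],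
      ∃ n' : ℤ, IsCoprime (p : ℤ) n' ∧ ∀ (m : ℕ) (dm : KolyvaginHeegnerData Dt β ι m)
        (γ : ringClassField K ι m ≃ₐ[ℚ] ringClassField K ι m), γ ∈ ringClassGal ι m →
        ∀ v : HeightOneSpectrum (𝓞 K), ¬ (W.baseChange K).HasGoodReductionAt v →
          n' • pointsMap (W.baseChange K) (v.adicCompletion K)
              (dm.toGeomPoints (pointGalHom W (ringClassField K ι m) γ dm.y)) ∈
            E0Receptacle (W.baseChange K) v ∧
          ∀ (ℓ : ℕ), ℓ ∈ m.primeFactors → ∀ (dm' : KolyvaginHeegnerData Dt β ι (m / ℓ))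
            (hle : ringClassField K ι (m / ℓ) ≤ ringClassField K ι m),
            n' • pointsMap (W.baseChange K) (v.adicCompletion K)
                (dm.toGeomPoints (pointGalHom W (ringClassField K ι m) γ
                  (WeierstrassCurve.Affine.Point.map (W' := W)
                    ((RingClassField.inclusion ι hle).restrictScalars ℚ) dm'.y))) ∈
              E0Receptacle (W.baseChange K) v)
    -- LOCAL PRINT-TO-TYPE
    (hloc : ∀ (W : WeierstrassCurve ℚ) [W.IsElliptic] [W.IsGloballyMinimal]
      (K : Type) [Field K] [NumberField K], IsImaginaryQuadratic K →
      ∀ (τ : K ≃ₐ[ℚ] K), τ ≠ 1 → ∀ (p k : ℕ) [Fact p.Prime], p ≠ 2 → 1 ≤ k →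
      ∀ (ℓ : ℕ), Zhang2014.IsKolyvaginPrime (W.conductorNorm ℤ) W K p ℓ →
        k ≤ Zhang2014.kolyvaginIndex W p ℓ →
      ∀ (v : HeightOneSpectrum (𝓞 K)), (ℓ : 𝓞 K) ∈ v.asIdeal → ∀ (hfix : τ • v = v)
        (s : ℤ), s = 1 ∨ s = -1 →
      ((W.baseChange K).kummerSelmerStructure ((p ^ k : ℕ) : ℤ) (Sum.inr v)).relIndex
        ((conjActPlace W τ ((p ^ k : ℕ) : ℤ) hfix - s • AddMonoidHom.id _).ker) = p ^ k)
    (h𝒯σ : ∀ (W : WeierstrassCurve ℚ) [W.IsElliptic] [W.IsGloballyMinimal]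
      (K : Type) [Field K] [NumberField K], IsImaginaryQuadratic K →
      ∀ (ι : K →+* ℂ) [∀ j : ℕ, NumberField (ringClassField K ι j)] (τ : K ≃ₐ[ℚ] K), τ ≠ 1 →
      ∀ (p k : ℕ) [Fact p.Prime], p ≠ 2 →
      ∀ (c : ℕ), Squarefree c → (∀ ℓ ∈ c.primeFactors,
        Zhang2014.IsKolyvaginPrime (W.conductorNorm ℤ) W K p ℓ ∧ k ≤ Zhang2014.kolyvaginIndex W p ℓ) →
      ∀ (𝒯 : SelmerStructure ((W.baseChange K).torsionGaloisModule ((p ^ k : ℕ) : ℤ))),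
      (∀ v : HeightOneSpectrum (𝓞 K), 𝒯 (Sum.inr v) =
        ⨅ ℓ ∈ c.primeFactors.filter (fun ℓ : ℕ ↦ ((ℓ : ℕ) : 𝓞 K) ∈ v.asIdeal),
          ⨅ (w' : HeightOneSpectrum (𝓞 (ringClassField K ι ℓ))) (_ : w'.asIdeal.LiesOver v.asIdeal),
            letI := (adicCompletionOfLiesOver K (ringClassField K ι ℓ) v w').toAlgebra
            transverseSubgroup (GaloisRep.toLocal v ((W.baseChange K).torsionGaloisModule ((p ^ k : ℕ) : ℤ)))
              (w'.adicCompletion (ringClassField K ι ℓ))) →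
      ∀ (v w : HeightOneSpectrum (𝓞 K)) (h : τ • v = w), v ∈ placesDividing K c →
      ∀ x : galoisCohomology (((W.baseChange K).torsionGaloisModule ((p ^ k : ℕ) : ℤ)).toLocal
        (Sum.inr v : Place K)) 1,
      x ∈ 𝒯 (Sum.inr v) → conjActPlace W τ ((p ^ k : ℕ) : ℤ) h x ∈ 𝒯 (Sum.inr w))
    (h𝒯sd : ∀ (W : WeierstrassCurve ℚ) [W.IsElliptic] [W.IsGloballyMinimal]
      (K : Type) [Field K] [NumberField K], IsImaginaryQuadratic K →
      ∀ (ι : K →+* ℂ) [∀ j : ℕ, NumberField (ringClassField K ι j)]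
      (p k : ℕ) [Fact p.Prime] [NeZero (p ^ k)] [Finite (geomTorsion (W.baseChange K) ((p ^ k : ℕ) : ℤ))],
      p ≠ 2 → ∀ (c : ℕ), Squarefree c → (∀ ℓ ∈ c.primeFactors,
        Zhang2014.IsKolyvaginPrime (W.conductorNorm ℤ) W K p ℓ ∧ k ≤ Zhang2014.kolyvaginIndex W p ℓ) →
      ∀ (𝒯 : SelmerStructure ((W.baseChange K).torsionGaloisModule ((p ^ k : ℕ) : ℤ))),
      (∀ v : HeightOneSpectrum (𝓞 K), 𝒯 (Sum.inr v) =
        ⨅ ℓ ∈ c.primeFactors.filter (fun ℓ : ℕ ↦ ((ℓ : ℕ) : 𝓞 K) ∈ v.asIdeal),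
          ⨅ (w' : HeightOneSpectrum (𝓞 (ringClassField K ι ℓ))) (_ : w'.asIdeal.LiesOver v.asIdeal),
            letI := (adicCompletionOfLiesOver K (ringClassField K ι ℓ) v w').toAlgebra
            transverseSubgroup (GaloisRep.toLocal v ((W.baseChange K).torsionGaloisModule ((p ^ k : ℕ) : ℤ)))
              (w'.adicCompletion (ringClassField K ι ℓ))) →
      ∀ (e : geomTorsion (W.baseChange K) ((p ^ k : ℕ) : ℤ) →
          geomTorsion (W.baseChange K) ((p ^ k : ℕ) : ℤ) → AlgebraicClosure K)
        (hμ : ∀ S T, e S T ^ (p ^ k) = 1)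
        (hadd₁ : ∀ S₁ S₂ T, e (S₁ + S₂) T = e S₁ T * e S₂ T)
        (hadd₂ : ∀ S T₁ T₂, e S (T₁ + T₂) = e S T₁ * e S T₂)
        (hgal : ∀ (g : absoluteGaloisGroup K) (S T : geomTorsion (W.baseChange K) ((p ^ k : ℕ) : ℤ)),
          g • e S T = e (g • S) (g • T)),
      (∀ T, e T T = 1) → (∀ T, (∀ S, e S T = 1) → T = 0) →
      ∀ inv : LocalInvariants K (p ^ k), inv.IsPerfect → ∀ v ∈ placesDividing K c,
      inv.dualTransported 𝒯 (weilDualIntertwining (W.baseChange K) (p ^ k) e hμ hadd₁ hadd₂ hgal)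
        (Sum.inr v) = 𝒯 (Sum.inr v))
    -- ROW / CARRIER datum (Kodaira–Néron)
    (hΦ : ∀ (W : WeierstrassCurve ℚ) [W.IsElliptic] [W.IsGloballyMinimal] (ℓ p : ℕ) [Fact ℓ.Prime]
      [Fact p.Prime], p ≠ 2 → p ∣ (W.baseChange ℚ_[ℓ]).localTamagawaNumber ℤ_[ℓ] →
      ∀ [(W.baseChange ℚ_[ℓ]).IsMinimal ℤ_[ℓ]],
      IsAddCyclic ((W.baseChange ℚ_[ℓ]).toAffine.Point ⧸ (W.baseChange ℚ_[ℓ]).goodReductionSubgroup ℤ_[ℓ]))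
    -- the completion-layer KERNEL GAPS
    (htr : ∀ (W : WeierstrassCurve ℚ) [W.IsElliptic] [W.IsGloballyMinimal] [NeZero (W.conductorNorm ℤ)]
      (K : Type) [Field K] [NumberField K], IsImaginaryQuadratic K →
      ∀ (p : ℕ) [Fact p.Prime], p ≠ 2 →
      ∀ (Dt : ModularParametrizationData W (W.conductorNorm ℤ)) (β : ℤ) (ι : K →+* ℂ)
        [∀ j : ℕ, NumberField (ringClassField K ι j)]
        (k : ℕ) (c : ℕ), Squarefree c →
        (∀ ℓ ∈ c.primeFactors, Zhang2014.IsKolyvaginPrime (W.conductorNorm ℤ) W K p ℓ ∧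
          k ≤ Zhang2014.kolyvaginIndex W p ℓ) →
      ∀ (d : KolyvaginHeegnerData Dt β ι c), ∀ ℓ ∈ c.primeFactors,
        (d.kolyvaginClass (Fact.out : p.Prime) k :
          galoisCohomology ((W.baseChange K).torsionGaloisModule ((p ^ k : ℕ) : ℤ)) 1) ∈
          transverseKer W K ι ((p ^ k : ℕ) : ℤ) ℓ)
    (h49str : ∀ (W : WeierstrassCurve ℚ) [W.IsElliptic] [W.IsGloballyMinimal] [NeZero (W.conductorNorm ℤ)]
      (K : Type) [Field K] [NumberField K], IsImaginaryQuadratic K →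
      SatisfiesHeegnerHypothesis (W.conductorNorm ℤ) K →
      ∀ (p : ℕ) [Fact p.Prime], p ≠ 2 →
      ∀ (Dt : ModularParametrizationData W (W.conductorNorm ℤ)) (β : ℤ) (ι : K →+* ℂ)
        [∀ j : ℕ, NumberField (ringClassField K ι j)]
        (k : ℕ) (hn : ((p ^ k : ℕ) : ℤ) ≠ 0) (c : ℕ), Squarefree c →
        (∀ ℓ ∈ c.primeFactors, Zhang2014.IsKolyvaginPrime (W.conductorNorm ℤ) W K p ℓ ∧
          k ≤ Zhang2014.kolyvaginIndex W p ℓ) →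
      ∀ (q : HeightOneSpectrum (𝓞 K)), ((W.conductorNorm ℤ : ℕ) : 𝓞 K) ∈ q.asIdeal →
      ∀ (ℓ : ℕ), Zhang2014.IsKolyvaginPrime (W.conductorNorm ℤ) W K p ℓ →
        k ≤ Zhang2014.kolyvaginIndex W p ℓ → ℓ ∉ c.primeFactors →
      ∀ (d' : KolyvaginHeegnerData Dt β ι (c * ℓ)),
        galoisCohomology.localization ((W.baseChange K).torsionGaloisModule ((p ^ k : ℕ) : ℤ))
            (Sum.inr q) 1 (d'.kolyvaginClass (Fact.out : p.Prime) k) ∈ stringentFamily W K hn (Sum.inr q)) :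
    ∀ (W : WeierstrassCurve ℚ) [W.IsElliptic] [W.IsGloballyMinimal] [NeZero (W.conductorNorm ℤ)],
      ¬ W.HasCM → ∀ (K : Type) [Field K] [NumberField K], IsImaginaryQuadratic K →
      NumberField.discr K ≠ -3 → NumberField.discr K ≠ -4 →
      SatisfiesHeegnerHypothesis (W.conductorNorm ℤ) K →
      ∀ (τ : K ≃ₐ[ℚ] K), τ ≠ 1 →
      ∀ (p : ℕ) [Fact p.Prime], p ≠ 2 → W.analyticRank = 0 → Addv W p → 0 ≤ padicValRat p W.j →
      W.HasIrreducibleModPGaloisRep p → ¬ (∀ n : ℕ, W.HasSurjectiveModNGaloisRep (p ^ n : ℕ)) →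
      (∃ Dt : ModularParametrizationData W (W.conductorNorm ℤ),
        (∀ z ∈ Dt.L.lattice, ∃ w ∈ periodLattice Dt.f, z = (Dt.c : ℂ) * w) ∧ ¬ (p : ℤ) ∣ Dt.c) →
      ∀ (Dt : ModularParametrizationData W (W.conductorNorm ℤ)) (β : ℤ) (ι : K →+* ℂ)
        [∀ k : ℕ, NumberField (ringClassField K ι k)]
        (d₁ : KolyvaginHeegnerData Dt β ι 1), ¬ IsOfFinAddOrder d₁.derivedPoint →
      ∀ (mdiv m : {c : ℕ // Squarefree c ∧ ∀ ℓ ∈ c.primeFactors,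
          Zhang2014.IsKolyvaginPrime (W.conductorNorm ℤ) W K p ℓ} → ℕ∞),
      (∀ c (u : ℕ), (u : ℕ∞) ≤ mdiv c ↔ ∀ d : KolyvaginHeegnerData Dt β ι c.1,
        ∃ Q : (W.baseChange (ringClassField K ι c.1)).toAffine.Point,
          ((p ^ u : ℕ) : ℤ) • Q = d.derivedPoint) →
      (∀ c, m c = if mdiv c < Zhang2014.levelIndex W p c.1 then mdiv c else ⊤) →
      ∀ mInf : ℕ, (∀ c, (mInf : ℕ∞) ≤ m c) →
        (∀ m' : ℕ, ∃ c, (m' : ℕ∞) ≤ Zhang2014.levelIndex W p c.1 ∧ m c = mInf) →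
      ∀ (k : ℕ) c, 1 ≤ k → Jetchev2008.IsGlobalCoreVertex W K ι τ p k c.1 → m c = mInf →
        (k : ℕ∞) + mInf ≤ Zhang2014.levelIndex W p c.1 →
        padicValNat p ((W.baseChange ℚ_[p]).localTamagawaNumber ℤ_[p]) < k → mInf < k →
        padicValNat p ((W.baseChange ℚ_[p]).localTamagawaNumber ℤ_[p]) ≤ mInf := by
  intro W _ _ _ hcm K _ _ hK hD3 hD4 hH τ hτ p _ hp2 _ hadd _ hirr _ _ Dt β ι _ d₁ _ mdiv m hmdiv hm mInf _ _
    k c hk hcore hmc hkM htk hik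
  have hp : p.Prime := Fact.out
  -- trivial case: `p ∤ c_p`
  by_cases ht0 : padicValNat p ((W.baseChange ℚ_[p]).localTamagawaNumber ℤ_[p]) = 0
  · rw [ht0]; exact Nat.zero_le _
  have hdvd : p ∣ (W.baseChange ℚ_[p]).localTamagawaNumber ℤ_[p] :=
    dvd_of_one_le_padicValNat (Nat.one_le_iff_ne_zero.mpr ht0)
  -- the carrier place `v₀ ∣ p` (`p ∣ N_E`: additive reduction), split, and the transport of the row data
  have hpN : p ∣ W.conductorNorm ℤ := (W.dvd_conductorNorm_iff_not_hasGoodReductionAtPrime p).mpr hadd.1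
  obtain ⟨v₀, hv₀, hv₀N, hpv₀⟩ := exists_split_place_of_dvd K hK τ hτ hH p hpN
  obtain ⟨hminK, hminP, hcEq, hc0, hcyc⟩ := carrierRowData_of_split W K p hK τ v₀ hv₀ hpv₀
  haveI := hminK
  haveI := hminP
  haveI := hcyc (hΦ W p p hp2 hdvd)
  -- `τ² = 1`
  haveI : Algebra.IsQuadraticExtension ℚ K := ⟨hK.1⟩
  have hτ2 : τ * τ = 1 := by
    have hcard : Nat.card (K ≃ₐ[ℚ] K) = 2 := by rw [IsGalois.card_aut_eq_finrank, hK.1]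
    obtain ⟨y, -, hyu⟩ := (Nat.card_eq_two_iff' (1 : K ≃ₐ[ℚ] K)).mp hcard
    have h1 : τ = y := hyu τ hτ
    have h2 : τ⁻¹ = y := hyu τ⁻¹ (inv_ne_one.mpr hτ)
    rw [mul_eq_one_iff_eq_inv]
    exact h1.trans h2.symm
  -- instances at level `p^k`
  haveI : NeZero (p ^ k) := ⟨pow_ne_zero k hp.ne_zero⟩
  haveI : Finite (geomTorsion (W.baseChange K) ((p ^ k : ℕ) : ℤ)) :=
    finite_geomTorsion_of_neZero (W.baseChange K) (p ^ k)
  have hn : ((p ^ k : ℕ) : ℤ) ≠ 0 := by exact_mod_cast pow_ne_zero k hp.ne_zero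
  -- the named-print schemas at this frame
  obtain ⟨ε, hε, h53'⟩ := h53 W K Dt β ι
  obtain ⟨n', hcop', hGZ'⟩ := hGZ W K p Dt β ι
  -- Kolyvagin data of the core vertex
  have hc0' : c.1 ≠ 0 := c.2.1.ne_zero
  have hkc : (k : ℕ∞) ≤ Zhang2014.levelIndex W p c.1 := le_trans le_self_add hkM
  have hcK : ∀ ℓ ∈ c.1.primeFactors, Zhang2014.IsKolyvaginPrime (W.conductorNorm ℤ) W K p ℓ ∧
      k ≤ Zhang2014.kolyvaginIndex W p ℓ := fun ℓ hℓ ↦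
    ⟨c.2.2 ℓ hℓ, Zhang2014.natCast_le_levelIndex_iff.mp hkc ℓ hℓ⟩
  -- the exponent
  have hfac : (((W.baseChange K).baseChange (v₀.adicCompletion K)).localTamagawaNumber
      (v₀.adicCompletionIntegers K)).factorization p =
      padicValNat p ((W.baseChange ℚ_[p]).localTamagawaNumber ℤ_[p]) := by
    rw [hcEq, Nat.factorization_def _ hp]
  have htk' : (((W.baseChange K).baseChange (v₀.adicCompletion K)).localTamagawaNumber
      (v₀.adicCompletionIntegers K)).factorization p < k := by rw [hfac]; exact htk
  -- `N ∈ τ • v₀` as well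
  have hv₀N' : ((W.conductorNorm ℤ : ℕ) : 𝓞 K) ∈ (τ • v₀).asIdeal := by
    have := (HeightOneSpectrum.smul_mem_smul_asIdeal_iff τ v₀ ((W.conductorNorm ℤ : ℕ) : 𝓞 K)).mpr hv₀N
    have hτN : τ • ((W.conductorNorm ℤ : ℕ) : 𝓞 K) = ((W.conductorNorm ℤ : ℕ) : 𝓞 K) := by
      rw [← MulSemiringAction.toRingHom_apply, map_natCast]
    rwa [hτN] at this
  -- the intrinsic transverse family (for `h49tr` from `htr` at level `cℓ`)
  obtain ⟨𝒯, h𝒯, hT⟩ := exists_localTransverseFamily W ι ((p ^ k : ℕ) : ℤ) hc0'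
  have key := JetchevIrreducibleLocalFacts.tamagawaExponent_le_mInfty_of_localFacts_of_irreducible_of_heegner h44I W
    hcm K hK hD3 hD4 hH (hPT K) p hp2 hirr hpN Dt β ι τ hτ hτ2 ε hε h53' hcop' hGZ' mdiv m hmdiv hm k hn c hk
    hcore mInf hmc hkM hik v₀ hv₀ hv₀N hc0 htk'
    (fun 𝒯' h𝒯' ↦ h𝒯σ W K hK ι τ hτ p k hp2 c.1 c.2.1 hcK 𝒯' h𝒯')
    (fun 𝒯' h𝒯' e hμ hadd₁ hadd₂ hgal halt hnondeg ↦
      h𝒯sd W K hK ι p k hp2 c.1 c.2.1 hcK 𝒯' h𝒯' e hμ hadd₁ hadd₂ hgal halt hnondeg)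
    (fun ℓ h1 h2 _ v hv hfix s hs ↦ hloc W K hK τ hτ p k hp2 hk ℓ h1 h2 v hv hfix s hs)
    (fun d ℓ hℓ ↦ htr W K hK p hp2 Dt β ι k c.1 c.2.1 hcK d ℓ hℓ)
    (fun ℓ h1 h2 h3 d' q hq ↦ by
      simp only [Finset.mem_insert, Finset.mem_singleton] at hq
      rcases hq with rfl | rfl
      · exact h49str W K hK hH p hp2 Dt β ι k hn c.1 c.2.1 hcK q hv₀N ℓ h1 h2 h3 d'
      · exact h49str W K hK hH p hp2 Dt β ι k hn c.1 c.2.1 hcK _ hv₀N' ℓ h1 h2 h3 d')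
    (fun ℓ h1 h2 h3 d' w hw ↦ by
      -- `h49tr` from `htr` at level `cℓ` through the reconciliation `hT`
      have hl : ℓ.Prime := h1.1
      have hlc : ¬ ℓ ∣ c.1 := fun h ↦ h3 (Nat.mem_primeFactors.mpr ⟨hl, h, hc0'⟩)
      have hcl : Squarefree (c.1 * ℓ) :=
        (Nat.squarefree_mul ((Nat.Prime.coprime_iff_not_dvd hl).mpr hlc).symm).mpr ⟨c.2.1, hl.squarefree⟩
      have hpf : (c.1 * ℓ).primeFactors = c.1.primeFactors ∪ {ℓ} := by
        rw [Nat.primeFactors_mul hc0' hl.ne_zero, hl.primeFactors]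
      have hcKℓ : ∀ l' ∈ (c.1 * ℓ).primeFactors, Zhang2014.IsKolyvaginPrime (W.conductorNorm ℤ) W K p l' ∧
          k ≤ Zhang2014.kolyvaginIndex W p l' := by
        intro l' hl'
        rw [hpf, Finset.mem_union, Finset.mem_singleton] at hl'
        rcases hl' with h | rfl
        · exact hcK l' h
        · exact ⟨h1, h2⟩
      rw [← h𝒯 w]
      refine (hT _).mpr (fun l' hl' ↦ ?_) w hw
      exact htr W K hK p hp2 Dt β ι k (c.1 * ℓ) hcl hcKℓ d' l'
        (by rw [hpf]; exact Finset.mem_union_left _ hl'))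
  rw [hfac] at key
  exact key

end Summit.BirchSwinnertonDyer.BirchSwinnertonDyer.Theorems.WildJetchevBoundAtPLocalFacts

end
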